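import Summits.HodgeConjecture.HodgeConjecture.Theorems.PadicSemiregularLiftFormalLiftingFromClassLiftingGlue

/-!
# Line `pro-class-correction-syntomic` — skeleton for crux `FormalLiftingFromClassLifting`
# (stmt-HodgeConjecture-13825), slim form after the glue landed (lead-2, third lead seat, 2026-08-16)

Crux P1a of route `PadicSemiregularLift` (`Theses/PadicSemiregularLift.lean`, item
stmt-HodgeConjecture-13825): for `k` perfect of characteristic `p`, `𝒳/W(k)` a smooth projective model
of relative dimension `d`, `d + 6 < p`, `H^b(𝒳,𝒪)` and `H^b(𝒳,Ω¹)` `p`-torsion-free,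
`d ≤ 3 ∨ Ω¹ free`, and a finite locally free `E₁` on `X_k` with (⋆) CLASS-LIFTS-IMPLY-OBJECT-LIFTS and
a rational pro-class `ξ ∈ (lim_n K₀(X_n)) ⊗ ℚ` under `[E₁] ⊗ 1`: `LiftsFormally 𝒳 E₁`.

This is the registered skeleton of line `pro-class-correction-syntomic` (planner
`planner-cruxplan-stmt-HodgeConjecture-13825-pro-class-correction-0`, built by lead-0 and lead-1)
reduced to what is NOT yet in `Theorems/`: the three registered stubs, byte-identical to the
registered signatures (S1 `stub_kernelTowerSurjective` = (2_K) kernel-tower surjectivity, hardest,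
held by the lead; S2 `stub_pSaturation`; S3 `stub_primeToPLifting`), and the one theorem concluding
the crux BY NAME, now a one-line application of the LANDED composition
`Theorems.FormalLiftingFromClassLifting.Glue.glue_formalLiftingFromClassLifting_of_stubs`
(`Theorems/PadicSemiregularLiftFormalLiftingFromClassLiftingGlue.lean`, p76799, which itself rests on
`Negative/ProClassCorrectionStubs.lean`, p74978: level `0` of every stub, clearing of denominators,
`exists_lift_all_levels_of_stubs`). `sorryAx` enters only through `stub_*`.

STATUS (three lead seats, two worker waves, four disprover cycles, one drefute pass — all concur):
no stub is false or misstated; none is closable at Mathlib v4.32.0 / this tree, because every level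
`n ≥ 1` of each needs the boundary of the RELATIVE `K`-theory sequence of the nilpotent thickening
`X_k ↪ X_{n+1}` — `π₀K(X_{n+1},X_k) → K₀(X_{n+1}) → K₀(X_k) →∂ π₋₁K(X_{n+1},X_k)` exact, `p`-primary of
finite exponent, finitely filtered with graded pieces the hypercohomology of the staircase complexes
`[p^{n(i−j)}Ω^j_{𝒳}]_j` (DGM + BMS2 Thm 1.12 + AMMN arXiv:2003.12541 Thm F(2) + Bouis arXiv:2412.06635
Prop 4.3) — for which neither Mathlib nor the tree has a carrier (no `K₁`, no negative/relative `K`,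
no THH/TC, no syntomic complexes, no de Rham COMPLEX of a scheme, no hypercohomology), and whose
`K₀`-level shadows are not in print as such (so not Literature named facts either). See
`Lines/pro-class-correction-syntomic.dead.md` and the crux `NOTES.md`.
-/

-- `Summit.HodgeConjecture.HodgeConjecture.…` repeats the summit name by the D-0017 layout (Sub = Summit).
set_option linter.dupNamespace false

namespace Summit.HodgeConjecture.HodgeConjecture.Cruxes.FormalLiftingFromClassLifting.ProClassCorrectionSyntomic

open CategoryTheory AlgebraicGeometry Limits
open Literature.AlgebraicGeometry
open Literature.AlgebraicGeometry.Motives Literature.AlgebraicGeometry.Motives.WittScheme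
open Summit.HodgeConjecture.HodgeConjecture.Theses.PadicSemiregularLift

noncomputable section

/-! ## 1. The registered stubs (the ONLY sorries of this file; signatures byte-identical to the registration) -/

/-- **S1 (HARDEST, held by the lead) — KERNEL-TOWER SURJECTIVITY (2_K) under the hypotheses of the crux.**
For `k` perfect of characteristic `p`, `𝒳/W(k)` a smooth proper model of relative dimension `d`,
projective over `W`, `d + 6 < p`, with `H^b(𝒳,𝒪)` and `H^b(𝒳,Ω¹)` `p`-torsion-free and
`d ≤ 3 ∨ Ω¹ free`: every `t ∈ K₀(X_{n+1})` restricting to `0` on `X_k` is the restriction of some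
`t' ∈ K₀(X_{n+2})` restricting to `0` on `X_k` (the clause `t'|X_k = 0` is automatic).
Paper proof (Disproof.lean (E1)–(E4) for `d ≤ 3`, (E7)+(H) for `Ω¹` free): `ker(K₀(X_m) → K₀(X_1))
= im π₀K(X_m, X_1)`; filtered DGM + BMS2 + AMMN Thm F(2) give a finite filtration of `π₀K(X_m,X_1)`
with graded pieces `ℍ^{2r−1}(X_1, Fil^r_1/Fil^r_m)`; torsion-free Hodge cohomology makes every
transition `m+1 → m` onto on graded pieces (lattice lemma (E2)); for `d ≤ 3` the only weight-crossing
differential starts at the relative determinant and vanishes (E3); Bouis Prop 4.3 (integral Adams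
`ψ^ℓ = ℓ^r` on `gr^r` of `Fil TC`) kills all differentials in weights `< p − 1` in general (H).
Level `0` is landed (`Negative.kernelTowerSurjective_level_zero`). BLOCKED at this pin for `n ≥ 1`:
no carrier for `π₀/π₋₁` of relative `K`-theory (see the module docstring). -/
theorem stub_kernelTowerSurjective :
    ∀ (p : ℕ) [Fact p.Prime] (k : Type) [Field k] [CharP k p] [PerfectRing k p] (d : ℕ)
      (𝒳 : SchemeOver (WittVector p k)),
      IsSmoothProperModel d 𝒳 → Crystalline.IsProjectiveOverRing 𝒳 → d + 6 < p →
      (∀ (b : ℕ) (x : structureSheafCohomology 𝒳.left b), (p : ℤ) • x = 0 → x = 0) →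
      (∀ (b : ℕ) (x : hodgeCohomologyOne 𝒳 b), (p : ℤ) • x = 0 → x = 0) →
      (d ≤ 3 ∨ Nonempty (cotangentSheaf 𝒳 ≅
        SheafOfModules.free (R := 𝒳.left.ringCatSheaf) (Fin d))) →
      ∀ (n : ℕ) (t : KTheory.KZero (thickening 𝒳 (n + 1)).left),
        KTheory.KZero.map (specialFibreToThickening 𝒳 n) t = 0 →
        ∃ t' : KTheory.KZero (thickening 𝒳 (n + 2)).left,
          KTheory.KZero.map (specialFibreToThickening 𝒳 (n + 1)) t' = 0 ∧
          KTheory.KZero.map (thickeningMap 𝒳 (Nat.le_succ (n + 1))) t' = t := by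
  sorry

/-- **S2 — `p`-SATURATION OF THE LEVEL-WISE IMAGES.** Same hypotheses on `𝒳` as S1. For every
`y ∈ K₀(X_k)`: if `p • y ∈ im(K₀(X_{n+1}) → K₀(X_k))` for every `n`, then `y ∈ im(K₀(X_{n+1}) → K₀(X_k))`
for every `n`. Paper proof (Disproof.lean (E5); BEK arXiv:1203.2776 Claim 49, Rem 35(2)): `y ∈ im_n ⟺
∂_n y = 0` in `π₋₁K(X_{n+1}, X_k)`, and the pro-group `lim_n π₋₁K(X_{n+1},X_k)` is torsion-free under
torsion-free Hodge cohomology (for `d ≤ 3` an extension of `H²(𝒳,𝒪)` by `H³(𝒳,Ω¹)`). Level `0` is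
landed (`Negative.exists_lift_level_zero`). BLOCKED at this pin for `n ≥ 1`: the obstruction group is
`π₋₁` of relative `K`-theory — no carrier; and "every abstract obstruction tower is torsion-free on
compatible families" is REFUTED as a typed residual (Disproof.lean (T5), `ℤ/p`-decoration). -/
theorem stub_pSaturation :
    ∀ (p : ℕ) [Fact p.Prime] (k : Type) [Field k] [CharP k p] [PerfectRing k p] (d : ℕ)
      (𝒳 : SchemeOver (WittVector p k)),
      IsSmoothProperModel d 𝒳 → Crystalline.IsProjectiveOverRing 𝒳 → d + 6 < p →
      (∀ (b : ℕ) (x : structureSheafCohomology 𝒳.left b), (p : ℤ) • x = 0 → x = 0) →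
      (∀ (b : ℕ) (x : hodgeCohomologyOne 𝒳 b), (p : ℤ) • x = 0 → x = 0) →
      (d ≤ 3 ∨ Nonempty (cotangentSheaf 𝒳 ≅
        SheafOfModules.free (R := 𝒳.left.ringCatSheaf) (Fin d))) →
      ∀ y : KTheory.KZero (specialFibre 𝒳).left,
        (∀ n : ℕ, ∃ z : KTheory.KZero (thickening 𝒳 (n + 1)).left,
          KTheory.KZero.map (specialFibreToThickening 𝒳 n) z = (p : ℤ) • y) →
        ∀ n : ℕ, ∃ z : KTheory.KZero (thickening 𝒳 (n + 1)).left,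
          KTheory.KZero.map (specialFibreToThickening 𝒳 n) z = y := by
  sorry

/-- **S3 (support-sized) — PRIME-TO-`p` DIVISIBILITY OF THE LEVEL-WISE IMAGES.** For `𝒳/W(k)` a smooth
proper model, projective over `W`, every level `n`, every `M` with `p ∤ M` and every `y ∈ K₀(X_k)`:
`M • y ∈ im(K₀(X_{n+1}) → K₀(X_k)) ⇒ y ∈ im(K₀(X_{n+1}) → K₀(X_k))`. Paper proof (Disproof.lean (K)):
`coker(K₀(X_{n+1}) → K₀(X_k)) ↪ π₋₁` of the relative Bass `K`-theory of the nilpotent immersion, which is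
`p`-primary of finite exponent (Weibel 1982 affine-locally: `K_*(A, I)` is a `p`-group for `I` nilpotent,
`p` nilpotent in `A`; Zariski descent). Level `0` landed (`Negative.primeToPDivisible_level_zero`).
BLOCKED at this pin for `n ≥ 1`: the `K₀`-level statement "(PP_n) the cokernel is `p`-primary of finite
exponent" is not in print for non-affine schemes (Geisser–Hesselholt JAMS 24 (2011) Thm A: rings;
BEK Prop 43(a): kernel side) and its proof needs `K₁`/negative `K` carriers. -/
theorem stub_primeToPLifting :
    ∀ (p : ℕ) [Fact p.Prime] (k : Type) [Field k] [CharP k p] [PerfectRing k p] (d : ℕ)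
      (𝒳 : SchemeOver (WittVector p k)),
      IsSmoothProperModel d 𝒳 → Crystalline.IsProjectiveOverRing 𝒳 →
      ∀ (n M : ℕ), ¬ p ∣ M → ∀ y : KTheory.KZero (specialFibre 𝒳).left,
        (∃ z : KTheory.KZero (thickening 𝒳 (n + 1)).left,
          KTheory.KZero.map (specialFibreToThickening 𝒳 n) z = (M : ℤ) • y) →
        ∃ z : KTheory.KZero (thickening 𝒳 (n + 1)).left,
          KTheory.KZero.map (specialFibreToThickening 𝒳 n) z = y := by
  sorry

/-! ## 2. The composition: the crux BY NAME from the three stubs, via the landed glue -/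

/-- **`FormalLiftingFromClassLifting` from S1, S2, S3** — the only theorem of this file concluding the
crux, by name, hypothesis-free: clearing denominators + S2 + S3 put `[E₁]` in the image of every
`K₀(X_{n+1}) → K₀(X_k)` (`Negative.exists_lift_all_levels_of_stubs`), S1 turns these level-wise lifts
into step class lifting for every finite-level lift of `E₁`, and (⋆) climbs the tower — all of this is
the landed `Glue.glue_formalLiftingFromClassLifting_of_stubs` (p76799). `sorryAx` enters only through
`stub_*`. -/
theorem FormalLiftingFromClassLifting_of : FormalLiftingFromClassLifting :=
  Theorems.FormalLiftingFromClassLifting.Glue.glue_formalLiftingFromClassLifting_of_stubs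
    stub_kernelTowerSurjective stub_pSaturation stub_primeToPLifting

end

end Summit.HodgeConjecture.HodgeConjecture.Cruxes.FormalLiftingFromClassLifting.ProClassCorrectionSyntomic
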